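import Summits.CriticalPhenomena.PercolationContinuityZ3.Theorems.PercNearOneGluingNoHeavyLowerTailCubicFourPointL1CertGlue
import Summits.CriticalPhenomena.PercolationContinuityZ3.Theorems.PercNearOneGluingNoHeavyLowerTailThreePointLBSwitching
import Summits.CriticalPhenomena.PercolationContinuityZ3.Theorems.PercNearOneGluingNoHeavyLowerTailHybridThreePointLB
import Literature.Probability.LatticeModels.ProdBernoulliIndependence
import Literature.Probability.LatticeModels.StrongHarrisKleitman
import HarnessLib

/-!
# Four-point certificate kernel, row layer: every VALID row is nonnegative on the cell law of a weighted graph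

Support file (prover prim-l12-p2, `--supports stmt-CriticalPhenomena-4575`).  No sorries, no named facts, no `native_decide`.
`RowSpec.valid` (decidable): `cell i` (`i < 15`); `harris E F` (both masks up-closed — Harris–FKG, `prodBernoulli_harris`);
`sunflower A petals glued` (`A`, `A ∪ Cᵢ` up-closed, cells pairwise disjoint, no duplicates — Gladkov's strong Harris–Kleitman
`prodBernoulli_strongHarris`, i.e. the AG and SF rows); `shk u v w glued` (labels `< 4` — 3PT-LB = SHK3⁺, `threePointLB_prodBernoulli`);
`hyb c P₁ P₃ P₃'` (`P₃ ⊆ P₃'` — hybrid 3PT-LB, `HybridThreePointLB.sahiE3_hybrid_nonneg`).  Glued rows are rows of the law with the edge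
`ay` forced open, rewritten in the original cells by `msum_preGlue`.  Main: `rowVal_nonneg_of_valid`.
-/

namespace Summit.CriticalPhenomena.PercolationContinuityZ3.Theorems

namespace FourPointCert

open MeasureTheory Finset SimpleGraph Literature.Probability.Percolation Literature.Probability.LatticeModels
open scoped Classical

/-! ### Validity of a row (decidable) -/

/-- Pairwise disjointness of the petals among themselves and from the core. [this work] -/
def petalsDisjoint (A : ℕ) (ps : List ℕ) : Bool :=
  ps.all fun m => (A &&& m == 0) && ps.all fun m' => m == m' || m &&& m' == 0

/-- **Validity of a row**: the decidable side conditions under which the row is a theorem on every weighted graph. [this work] -/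
def RowSpec.valid : RowSpec → Bool
  | .cell i => decide (i < 15)
  | .harris E F => isUp E && isUp F
  | .sunflower A ps _ => isUp A && ps.all (fun p => isUp (A ||| p)) && petalsDisjoint A ps && decide ps.Nodup
  | .shk u v t _ => decide (u < 4) && decide (v < 4) && decide (t < 4)
  | .hyb c _ P₃ P₃' => decide (c < 4) && (P₃ &&& P₃' == P₃)

variable {V : Type*} [Fintype V] [DecidableEq V] (a b c y : V) (w : Sym2 V → unitInterval)

/-! ### Harris rows -/

omit [DecidableEq V] in
/-- **Harris rows**: `σ·m(E ∩ F) − m(E)m(F) ≥ 0` for up-closed masks. [this work] -/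
theorem rowVal_harris_nonneg {E F : ℕ} (hE : isUp E = true) (hF : isUp F = true) :
    0 ≤ rowVal (.harris E F) (cellLaw a b c y w) := by
  have h := prodBernoulli_harris w (isUpperSet_pre a b c y hE) (isUpperSet_pre a b c y hF) (measurableSet_of_fintype _)
    (measurableSet_of_fintype _)
  rw [← pre_and, real_pre, real_pre, real_pre] at h
  simp only [rowVal, msum_full_cellLaw, one_mul]
  linarith

/-! ### Sunflower rows (Gladkov's strong Harris–Kleitman) -/

/-- `2·e₂(l) = (Σ l)² − Σ l²`. [this work] -/
theorem two_mul_e2val : ∀ l : List ℝ, 2 * e2val l = l.sum ^ 2 - (l.map fun t => t ^ 2).sum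
  | [] => by simp [e2val]
  | t :: l => by rw [e2val, List.sum_cons, List.map_cons, List.sum_cons, mul_add, two_mul_e2val l]; ring

omit [Fintype V] [DecidableEq V] in
/-- Disjoint masks give disjoint events. [this work] -/
theorem disjoint_pre {T₁ T₂ : ℕ} (h : T₁ &&& T₂ = 0) : Disjoint (pre a b c y T₁) (pre a b c y T₂) := by
  rw [Set.disjoint_iff_inter_eq_empty, ← pre_and, h]
  ext ω; simp [pre]

omit [Fintype V] [DecidableEq V] in
/-- The union of the petal events is the event of the union mask. [this work] -/
theorem pre_unionMasks : ∀ ps : List ℕ, (⋃ m ∈ ps.toFinset, pre a b c y m) = pre a b c y (unionMasks ps)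
  | [] => by ext ω; simp [unionMasks, pre]
  | m :: ps => by
    rw [List.toFinset_cons, Finset.set_biUnion_insert, pre_unionMasks ps, show unionMasks (m :: ps) = m ||| unionMasks ps from rfl,
      pre_or]

omit [DecidableEq V] in
/-- **Sunflower rows** (`AG`, `SF_top`, `SF_bot`): `m(A)m(B) − e₂(m(Cᵢ)) ≥ 0`. [this work] -/
theorem rowVal_sunflower_nonneg {A : ℕ} {ps : List ℕ} (hA : isUp A = true) (hup : ∀ p ∈ ps, isUp (A ||| p) = true)
    (hdis : petalsDisjoint A ps = true) (hnd : ps.Nodup) : 0 ≤ rowVal (.sunflower A ps false) (cellLaw a b c y w) := by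
  simp only [petalsDisjoint, List.all_eq_true, Bool.and_eq_true, beq_iff_eq, Bool.or_eq_true] at hdis
  have h := prodBernoulli_strongHarris w ps.toFinset (A := pre a b c y A) (C := fun m => pre a b c y m)
    (fun i hi j hj hij => by
      rw [List.mem_toFinset] at hi hj
      rcases (hdis i hi).2 j hj with h | h
      · exact absurd h hij
      · exact disjoint_pre a b c y h)
    (fun i hi => by rw [List.mem_toFinset] at hi; exact disjoint_pre a b c y (hdis i hi).1)
    (fun i hi => by rw [List.mem_toFinset] at hi; rw [← pre_or]; exact isUpperSet_pre a b c y (hup i hi))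
    (isUpperSet_pre a b c y hA)
  rw [pre_unionMasks, ← pre_or, ← pre_xor_full, List.sum_toFinset _ hnd, List.sum_toFinset _ hnd] at h
  simp only [real_pre] at h
  have h2 := two_mul_e2val (ps.map fun p => msum p (cellLaw a b c y w))
  rw [List.map_map, Function.comp_def] at h2
  simp only [rowVal, Bool.false_eq_true, ↓reduceIte]
  linarith [h, h2]

/-! ### SHK3⁺ rows (3PT-LB) -/

omit [Fintype V] [DecidableEq V] in
/-- Negated membership form of `jn_pat`. [this work] -/
theorem jn_pat_false_iff (ω : BondConfig V) {u v : ℕ} (hu : u < 4) (hv : v < 4) :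
    jn (pat a b c y ω) u v = false ↔ ω ∉ openConn (lab a b c y u) (lab a b c y v) := by
  rw [← jn_pat_iff a b c y ω hu hv, Bool.eq_false_iff]

omit [DecidableEq V] in
/-- **SHK3⁺ rows**: `(σ + t)(qt − e₂(u)) − e₃(u) ≥ 0` on the three-point marginal of labels `u v t < 4`. [this work] -/
theorem rowVal_shk_nonneg {u v t : ℕ} (hu : u < 4) (hv : v < 4) (ht : t < 4) :
    0 ≤ rowVal (.shk u v t false) (cellLaw a b c y w) := by
  have h := ThreePointLB.threePointLB_prodBernoulli w (lab a b c y u) (lab a b c y v) (lab a b c y t)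
  have eT : openConn (lab a b c y u) (lab a b c y v) ∩ openConn (lab a b c y u) (lab a b c y t) =
      pre a b c y (maskOf fun π => jn π u v && jn π u t) := by
    ext ω; rw [mem_pre_maskOf, Bool.and_eq_true, jn_pat_iff a b c y ω hu hv, jn_pat_iff a b c y ω hu ht]; rfl
  have eQ : (openConn (lab a b c y u) (lab a b c y v))ᶜ ∩ (openConn (lab a b c y u) (lab a b c y t))ᶜ ∩
      (openConn (lab a b c y v) (lab a b c y t))ᶜ = pre a b c y (maskOf fun π => !jn π u v && !jn π u t && !jn π v t) := by
    ext ω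
    rw [mem_pre_maskOf, Bool.and_eq_true, Bool.and_eq_true, Bool.not_eq_true', Bool.not_eq_true', Bool.not_eq_true',
      jn_pat_false_iff a b c y ω hu hv, jn_pat_false_iff a b c y ω hu ht, jn_pat_false_iff a b c y ω hv ht]
    simp only [Set.mem_inter_iff, Set.mem_compl_iff]
  have e1 : openConn (lab a b c y u) (lab a b c y v) ∩ (openConn (lab a b c y u) (lab a b c y t))ᶜ =
      pre a b c y (maskOf fun π => jn π u v && !jn π u t) := by
    ext ω; rw [mem_pre_maskOf, Bool.and_eq_true, Bool.not_eq_true', jn_pat_iff a b c y ω hu hv, jn_pat_false_iff a b c y ω hu ht]; rfl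
  have e2 : openConn (lab a b c y u) (lab a b c y t) ∩ (openConn (lab a b c y u) (lab a b c y v))ᶜ =
      pre a b c y (maskOf fun π => jn π u t && !jn π u v) := by
    ext ω; rw [mem_pre_maskOf, Bool.and_eq_true, Bool.not_eq_true', jn_pat_iff a b c y ω hu ht, jn_pat_false_iff a b c y ω hu hv]; rfl
  have e3 : openConn (lab a b c y v) (lab a b c y t) ∩ (openConn (lab a b c y u) (lab a b c y v))ᶜ =
      pre a b c y (maskOf fun π => jn π v t && !jn π u v) := by
    ext ω; rw [mem_pre_maskOf, Bool.and_eq_true, Bool.not_eq_true', jn_pat_iff a b c y ω hv ht, jn_pat_false_iff a b c y ω hu hv]; rfl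
  rw [eT, eQ, e1, e2, e3] at h
  simp only [real_pre] at h
  simp only [rowVal, law3, Bool.false_eq_true, ↓reduceIte, e2val, List.sum_cons, List.sum_nil, msum_full_cellLaw]
  nlinarith [h]

/-! ### Hybrid three-point rows -/

/-- The label set of a 4-bit mask. [this work] -/
def labSet (X : ℕ) : Finset V := ((Finset.range 4).filter fun u => X.testBit u = true).image (lab a b c y)

omit [Fintype V] [DecidableEq V] in
/-- `(¬(p ∧ q) ∨ ¬r)` on Booleans. [this work] -/
theorem bool_imp3 (p q r : Bool) : ((!(p && q) || !r) = true) ↔ (p = true → q = true → r = false) := by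
  cases p <;> cases q <;> cases r <;> simp

omit [Fintype V] in
/-- Membership in `pre (gsepMask X Y)`: no label of `X` is joined to a label of `Y`. [this work] -/
theorem mem_pre_gsepMask (X Y : ℕ) (ω : BondConfig V) :
    ω ∈ pre a b c y (gsepMask X Y) ↔ ∀ u ∈ labSet a b c y X, ∀ v ∈ labSet a b c y Y, ω ∉ openConn u v := by
  rw [gsepMask, mem_pre_maskOf]
  simp only [List.all_eq_true, List.mem_range, bool_imp3, labSet, Finset.forall_mem_image, Finset.mem_filter, Finset.mem_range,
    and_imp]
  constructor
  · intro h u hu hX v hv hY; exact (jn_pat_false_iff a b c y ω hu hv).1 (h u hu v hv hX hY)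
  · intro h u hu v hv hX hY; exact (jn_pat_false_iff a b c y ω hu hv).2 (h hu hX hv hY)

omit [Fintype V] in
/-- The label set of a single label. [this work] -/
theorem labSet_two_pow {u : ℕ} (hu : u < 4) : labSet a b c y (2 ^ u) = {lab a b c y u} := by
  ext v
  simp only [labSet, Finset.mem_image, Finset.mem_filter, Finset.mem_range, Finset.mem_singleton, Nat.testBit_two_pow,
    decide_eq_true_eq]
  constructor
  · rintro ⟨u', ⟨-, rfl⟩, rfl⟩; rfl
  · intro h; exact ⟨u, ⟨hu, rfl⟩, h.symm⟩

omit [Fintype V] in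
/-- Label sets are monotone under bitwise inclusion. [this work] -/
theorem labSet_mono {X Y : ℕ} (h : X &&& Y = X) : labSet a b c y X ⊆ labSet a b c y Y := by
  intro v hv
  simp only [labSet, Finset.mem_image, Finset.mem_filter, Finset.mem_range] at hv ⊢
  obtain ⟨u, ⟨hu, hX⟩, rfl⟩ := hv
  refine ⟨u, ⟨hu, ?_⟩, rfl⟩
  have := congrArg (fun n => n.testBit u) h
  simp only [Nat.testBit_and, hX, Bool.true_and] at this
  exact this

/-- **Hybrid three-point rows** `E₃({P₁ ≁ c}, {c ≁ P₃}, {P₁ ≁ P₃'}) ≥ 0` (`P₃ ⊆ P₃'`). [this work] -/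
theorem rowVal_hyb_nonneg {c' P₁ P₃ P₃' : ℕ} (hc : c' < 4) (hsub : P₃ &&& P₃' = P₃) :
    0 ≤ rowVal (.hyb c' P₁ P₃ P₃') (cellLaw a b c y w) := by
  have h := HybridThreePointLB.sahiE3_hybrid_nonneg w (lab a b c y c') (labSet a b c y P₁) (labSet a b c y P₃) (labSet a b c y P₃')
    (labSet_mono a b c y hsub)
  have S : ∀ (ω : BondConfig V) (u v : V), ω ∈ openConn u v ↔ ω ∈ openConn v u := fun ω u v => ⟨Reachable.symm, Reachable.symm⟩
  have e1 : {ω : BondConfig V | ∀ u ∈ labSet a b c y P₁, ω ∉ openConn (lab a b c y c') u} = pre a b c y (gsepMask (2 ^ c') P₁) := by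
    ext ω; rw [mem_pre_gsepMask, labSet_two_pow a b c y hc]; simp
  have e2 : {ω : BondConfig V | ∀ v ∈ labSet a b c y P₃, ω ∉ openConn (lab a b c y c') v} = pre a b c y (gsepMask (2 ^ c') P₃) := by
    ext ω; rw [mem_pre_gsepMask, labSet_two_pow a b c y hc]; simp
  have e3 : {ω : BondConfig V | ∀ v ∈ labSet a b c y P₃', ∀ u ∈ labSet a b c y P₁, ω ∉ openConn v u} =
      pre a b c y (gsepMask P₁ P₃') := by
    ext ω; rw [mem_pre_gsepMask]; simp only [Set.mem_setOf_eq]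
    constructor
    · intro h' u hu v hv; rw [S]; exact h' v hv u hu
    · intro h' v hv u hu; rw [S]; exact h' u hu v hv
  rw [e1, e2, e3, sahiE3_def] at h
  simp only [← pre_and, real_pre] at h
  simp only [rowVal, e3val, msum_full_cellLaw]
  linarith

/-! ### Glued rows: the law with `ay` forced open -/

/-- A glued sunflower row is the plain row of the glued law. [this work] -/
theorem rowVal_sunflower_glued (A : ℕ) (ps : List ℕ) :
    rowVal (.sunflower A ps true) (cellLaw a b c y w) = rowVal (.sunflower A ps false) (cellLaw a b c y (Function.update w s(a, y) 1)) := by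
  simp only [rowVal, ↓reduceIte, Bool.false_eq_true, msum_preGlue]

/-- A glued SHK3⁺ row is the plain row of the glued law. [this work] -/
theorem rowVal_shk_glued (u v t : ℕ) :
    rowVal (.shk u v t true) (cellLaw a b c y w) = rowVal (.shk u v t false) (cellLaw a b c y (Function.update w s(a, y) 1)) := by
  simp only [rowVal, law3, ↓reduceIte, Bool.false_eq_true, msum_preGlue, msum_full_cellLaw]

/-! ### Main: valid rows are nonnegative -/

/-- **Every valid row is nonnegative on the cell law of every weighted graph** (any labels, coincidences allowed). [this work] -/
theorem rowVal_nonneg_of_valid (r : RowSpec) (hr : r.valid = true) (w : Sym2 V → unitInterval) :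
    0 ≤ rowVal r (cellLaw a b c y w) := by
  cases r with
  | cell i => exact cellLaw_nonneg a b c y w i
  | harris E F =>
    simp only [RowSpec.valid, Bool.and_eq_true] at hr
    exact rowVal_harris_nonneg a b c y w hr.1 hr.2
  | sunflower A ps glued =>
    simp only [RowSpec.valid, Bool.and_eq_true, List.all_eq_true, decide_eq_true_eq] at hr
    cases glued with
    | false => exact rowVal_sunflower_nonneg a b c y w hr.1.1.1 hr.1.1.2 hr.1.2 hr.2
    | true =>
      rw [rowVal_sunflower_glued]
      exact rowVal_sunflower_nonneg a b c y _ hr.1.1.1 hr.1.1.2 hr.1.2 hr.2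
  | shk u v t glued =>
    simp only [RowSpec.valid, Bool.and_eq_true, decide_eq_true_eq] at hr
    cases glued with
    | false => exact rowVal_shk_nonneg a b c y w hr.1.1 hr.1.2 hr.2
    | true =>
      rw [rowVal_shk_glued]
      exact rowVal_shk_nonneg a b c y _ hr.1.1 hr.1.2 hr.2
  | hyb c' P₁ P₃ P₃' =>
    simp only [RowSpec.valid, Bool.and_eq_true, decide_eq_true_eq, beq_iff_eq] at hr
    exact rowVal_hyb_nonneg a b c y w hr.1 hr.2

end FourPointCert

end Summit.CriticalPhenomena.PercolationContinuityZ3.Theorems
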